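import Literature.Computability.Cryptography.ComPRGSpec
import HarnessLib

/-!
# A pseudorandom generator from a bit-commitment scheme, II: the candidate generators are polynomial-time

Topic `Literature/Computability/Cryptography`; sequel of `ComPRGSpec.lean` (M. Luby, *Pseudorandomness and
Cryptographic Applications*, 1996, Lecture 10, Thm. 10.3, over the false-entropy generator of a bit-commitment
scheme). This file programs the indexed sampler `ComPRG.Setup.candI S` ("`⟨1ⁿ, ⟨1ⁱ, s⟩⟩ ↦ cand S n i s`") with
the tree's `FP` brick algebra and proves **`candI_mem_FP`**: for a well-formed setup (the sender polynomial-time)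
the whole family of candidate generators is ONE polynomial-time function of (level, index, seed) — the
hypothesis `S ∈ FP` of `XorCombiner.isPseudorandom_xorCombiner` and `PRGStretchI.isPseudorandom_genI`.

The program: unary parameter bricks (`JU, L0U, QcU, cstU, t4U, tU, ΔU, slU, xLenU, m1U, m2U, M1U, LzU, K1U, K2U`,
each with a value lemma `⋯_apply : ⋯ w = ones (⋯ |fstF w|)`), the index split `divModFn` (coin-count guess
`ρ̃ = i mod (J+1)`, entropy guess `j = i / (J+1)`), the seed split (`κ₁, κ₂, x` by `takeFn/dropFn`), the coded tuple
`zStr` as a `foldCat` over the `t` blocks whose body commits with the sender's own machine (`comB`, from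
`IsEfficient`) and pads (`pieceF_apply`), the two affine hashes (`AffineProg.hashFn`) and the final assembly
(`candFn_apply : candFn S w = candI S w` on every input). All proved; no named facts.

## References

* M. Luby, *Pseudorandomness and Cryptographic Applications*, Princeton University Press 1996, Lecture 10,
  Thm. 10.3 ("`g` … is a **P**-time function ensemble").
* S. Arora, B. Barak, *Computational Complexity: A Modern Approach*, CUP 2009, §1.3–1.4 (machine toolkit).
-/

namespace Literature.Computability.Cryptography

open _root_.Computability Complexity Complexity.Brick Complexity.Plumb Polynomial Hybrid AffineStr

namespace ComPRG

namespace Setup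

variable (S : Setup)

/-! ### Unary parameter bricks (functions of the level string `u`, `n = |u|`) -/

section Params

/-- `1^{J n}` from `u`. [folklore] -/
noncomputable def JU : List Bool → List Bool := polyFn S.Jp ∘ polyFn (2 * X + 3)
/-- `1^{L0 n}`. [folklore] -/
noncomputable def L0U : List Bool → List Bool := List.cons true ∘ S.JU
/-- `1^{Qc n}`. [folklore] -/
noncomputable def QcU : List Bool → List Bool := polyFn S.Qp ∘ fun u => polyFn (2 * X + 6) u ++ S.JU u
/-- `1^{cst n}`. [folklore] -/
noncomputable def cstU : List Bool → List Bool := fun u => S.L0U u ++ (S.L0U u ++ [true, true])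
/-- `1^{n+1}`. [folklore] -/
noncomputable def lvl1U : List Bool → List Bool := List.cons true ∘ onesFn
/-- `1^{t4 n}`. [folklore] -/
noncomputable def t4U : List Bool → List Bool :=
  HashBricks.umulFn ∘ fanoutFn (HashBricks.umulFn ∘ fanoutFn S.cstU S.cstU) lvl1U
/-- `1^{t n}`. [folklore] -/
noncomputable def tU : List Bool → List Bool := fun u => S.t4U u ++ (S.t4U u ++ (S.t4U u ++ S.t4U u))
/-- `1^{Δ n}`. [folklore] -/
noncomputable def ΔU : List Bool → List Bool :=
  HashBricks.umulFn ∘ fanoutFn S.L0U (HashBricks.umulFn ∘ fanoutFn (fun u => S.cstU u ++ S.cstU u) lvl1U)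
/-- `1^{xLen n}`. [folklore] -/
noncomputable def xLenU : List Bool → List Bool := HashBricks.umulFn ∘ fanoutFn S.tU S.L0U
/-- `1^{M1 n}`. [folklore] -/
noncomputable def M1U : List Bool → List Bool := fun u => S.xLenU u ++ S.tU u
/-- `1^{Lz n}`. [folklore] -/
noncomputable def LzU : List Bool → List Bool := fun u => S.QcU u ++ (S.QcU u ++ [true])
/-- `1^{t n · Lz n}` (the length of the coded tuple). [folklore] -/
noncomputable def tLzU : List Bool → List Bool := HashBricks.umulFn ∘ fanoutFn S.tU S.LzU
/-- `1^{K1 n}`. [folklore] -/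
noncomputable def K1U : List Bool → List Bool := HashBricks.umulFn ∘ fanoutFn S.M1U (List.cons true ∘ S.tLzU)
/-- `1^{K2 n}`. [folklore] -/
noncomputable def K2U : List Bool → List Bool := HashBricks.umulFn ∘ fanoutFn S.xLenU (List.cons true ∘ S.xLenU)
/-- `1^{Δ + 2·sl + 1}` (the common subtrahend of `m1`, `m2`). [folklore] -/
noncomputable def subU : List Bool → List Bool := fun u => S.ΔU u ++ (lvl1U u ++ (lvl1U u ++ [true]))
/-- `⟨1^{jOf n i}, 1^{rhoOf n i}⟩` from `w = ⟨u, ⟨v, s⟩⟩` (`i = |v|`). [folklore] -/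
noncomputable def dmU : List Bool → List Bool := divModFn ∘ fanoutFn (S.L0U ∘ fstF) (onesFn ∘ fstF ∘ sndF)
/-- `1^{jOf n i}`. [folklore] -/
noncomputable def jU : List Bool → List Bool := fstF ∘ S.dmU
/-- `1^{rhoOf n i}`. [folklore] -/
noncomputable def rhoU : List Bool → List Bool := sndF ∘ S.dmU
/-- `1^{m1 n j}` from `w`. [folklore] -/
noncomputable def m1U : List Bool → List Bool :=
  dropFn ∘ fanoutFn (S.subU ∘ fstF) (fun w => (HashBricks.umulFn ∘ fanoutFn (S.t4U ∘ fstF) S.jU) w ++ S.tU (fstF w))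
/-- `1^{m2 n j}` from `w`. [folklore] -/
noncomputable def m2U : List Bool → List Bool :=
  dropFn ∘ fanoutFn (fun w => (HashBricks.umulFn ∘ fanoutFn (S.t4U ∘ fstF) (List.cons true ∘ S.jU)) w ++ S.subU (fstF w))
    (S.xLenU ∘ fstF)

variable {S}

/-- `ones_append`. [folklore] -/
private theorem ones_append (a b : ℕ) : ones a ++ ones b = ones (a + b) := by
  rw [ones, ones, ones, List.replicate_append_replicate]
/-- `ones_append_true`. [folklore] -/
private theorem ones_append_true (a : ℕ) : ones a ++ [true] = ones (a + 1) := by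
  rw [ones, ones, List.replicate_succ']
/-- `length_ones'`. [folklore] -/
private theorem length_ones' (a : ℕ) : (ones a).length = a := List.length_replicate ..
/-- `drop_ones`. [folklore] -/
private theorem drop_ones (a b : ℕ) : dropFn (boolPair (ones a) (ones b)) = ones (b - a) := by
  rw [dropFn_boolPair, length_ones', ones, ones, List.drop_replicate]
/-- `onesFn_eq`. [folklore] -/
private theorem onesFn_eq (u : List Bool) : onesFn u = ones u.length := unaryEncodeNat_eq_replicate _

/-- `JU_apply`. [folklore] -/
theorem JU_apply (u : List Bool) : S.JU u = ones (S.J u.length) := by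
  simp only [JU, Function.comp_apply, polyFn_apply, length_ones', eval_add, eval_mul, eval_ofNat, eval_X, J]

/-- `L0U_apply`. [folklore] -/
theorem L0U_apply (u : List Bool) : S.L0U u = ones (S.L0 u.length) := by
  rw [L0U, Function.comp_apply, JU_apply, AffineProg.true_cons_ones, L0]

/-- `QcU_apply`. [folklore] -/
theorem QcU_apply (u : List Bool) : S.QcU u = ones (S.Qc u.length) := by
  simp only [QcU, Function.comp_apply, polyFn_apply, JU_apply, ones_append, length_ones', eval_add, eval_mul,
    eval_ofNat, eval_X, Qc]

/-- `cstU_apply`. [folklore] -/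
theorem cstU_apply (u : List Bool) : S.cstU u = ones (S.cst u.length) := by
  rw [cstU, L0U_apply, show [true, true] = ones 2 from rfl, ones_append, ones_append, cst]
  congr 1; ring

/-- `lvl1U_apply`. [folklore] -/
theorem lvl1U_apply (u : List Bool) : lvl1U u = ones (u.length + 1) := by
  rw [lvl1U, Function.comp_apply, onesFn_eq, AffineProg.true_cons_ones]

/-- `t4U_apply`. [folklore] -/
theorem t4U_apply (u : List Bool) : S.t4U u = ones (S.t4 u.length) := by
  simp only [t4U, Function.comp_apply, fanoutFn_apply, cstU_apply, lvl1U_apply, HashBricks.umulFn_boolPair, t4, sq]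

/-- `tU_apply`. [folklore] -/
theorem tU_apply (u : List Bool) : S.tU u = ones (S.t u.length) := by
  rw [tU, t4U_apply, ones_append, ones_append, ones_append, t]
  congr 1; ring

/-- `ΔU_apply`. [folklore] -/
theorem ΔU_apply (u : List Bool) : S.ΔU u = ones (S.Δ u.length) := by
  simp only [ΔU, Function.comp_apply, fanoutFn_apply, cstU_apply, L0U_apply, lvl1U_apply, ones_append,
    HashBricks.umulFn_boolPair, Δ]
  congr 1; ring

/-- `xLenU_apply`. [folklore] -/
theorem xLenU_apply (u : List Bool) : S.xLenU u = ones (S.xLen u.length) := by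
  simp only [xLenU, Function.comp_apply, fanoutFn_apply, tU_apply, L0U_apply, HashBricks.umulFn_boolPair, xLen]

/-- `M1U_apply`. [folklore] -/
theorem M1U_apply (u : List Bool) : S.M1U u = ones (S.M1 u.length) := by
  rw [M1U, xLenU_apply, tU_apply, ones_append, M1]

/-- `LzU_apply`. [folklore] -/
theorem LzU_apply (u : List Bool) : S.LzU u = ones (S.Lz u.length) := by
  rw [LzU, QcU_apply, ones_append_true, ones_append, Lz]
  congr 1; ring

/-- `tLzU_apply`. [folklore] -/
theorem tLzU_apply (u : List Bool) : S.tLzU u = ones (S.t u.length * S.Lz u.length) := by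
  simp only [tLzU, Function.comp_apply, fanoutFn_apply, tU_apply, LzU_apply, HashBricks.umulFn_boolPair]

/-- `K1U_apply`. [folklore] -/
theorem K1U_apply (u : List Bool) : S.K1U u = ones (S.K1 u.length) := by
  simp only [K1U, Function.comp_apply, fanoutFn_apply, M1U_apply, tLzU_apply, AffineProg.true_cons_ones,
    HashBricks.umulFn_boolPair, K1]

/-- `K2U_apply`. [folklore] -/
theorem K2U_apply (u : List Bool) : S.K2U u = ones (S.K2 u.length) := by
  simp only [K2U, Function.comp_apply, fanoutFn_apply, xLenU_apply, AffineProg.true_cons_ones, HashBricks.umulFn_boolPair, K2]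

/-- `subU_apply`. [folklore] -/
theorem subU_apply (u : List Bool) : S.subU u = ones (S.Δ u.length + 2 * sl u.length + 1) := by
  rw [subU, ΔU_apply, lvl1U_apply, ones_append_true, ones_append, ones_append, sl]
  congr 1; ring

/-- `dmU_apply`. [folklore] -/
theorem dmU_apply (w : List Bool) :
    S.dmU w = boolPair (ones (S.jOf (fstF w).length (fstF (sndF w)).length)) (ones (S.rhoOf (fstF w).length (fstF (sndF w)).length)) := by
  rw [dmU, Function.comp_apply, fanoutFn_apply, Function.comp_apply, L0U_apply, Function.comp_apply, Function.comp_apply,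
    onesFn_eq, divModFn_boolPair, jOf, rhoOf, L0]

/-- `jU_apply`. [folklore] -/
theorem jU_apply (w : List Bool) : S.jU w = ones (S.jOf (fstF w).length (fstF (sndF w)).length) := by
  rw [jU, Function.comp_apply, dmU_apply, fstF_boolPair]

/-- `rhoU_apply`. [folklore] -/
theorem rhoU_apply (w : List Bool) : S.rhoU w = ones (S.rhoOf (fstF w).length (fstF (sndF w)).length) := by
  rw [rhoU, Function.comp_apply, dmU_apply, sndF_boolPair]

/-- `m1U_apply`. [folklore] -/
theorem m1U_apply (w : List Bool) : S.m1U w = ones (S.m1 (fstF w).length (S.jOf (fstF w).length (fstF (sndF w)).length)) := by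
  rw [m1U, Function.comp_apply, fanoutFn_apply, Function.comp_apply, subU_apply, Function.comp_apply, fanoutFn_apply,
    Function.comp_apply, t4U_apply, jU_apply, HashBricks.umulFn_boolPair, tU_apply, ones_append, drop_ones, m1]
  congr 1; omega

/-- `m2U_apply`. [folklore] -/
theorem m2U_apply (w : List Bool) : S.m2U w = ones (S.m2 (fstF w).length (S.jOf (fstF w).length (fstF (sndF w)).length)) := by
  rw [m2U, Function.comp_apply, fanoutFn_apply, Function.comp_apply, fanoutFn_apply, Function.comp_apply, t4U_apply,
    Function.comp_apply, jU_apply, AffineProg.true_cons_ones, HashBricks.umulFn_boolPair, subU_apply, ones_append,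
    Function.comp_apply, xLenU_apply, drop_ones, m2]
  congr 1; omega

/-! #### `FP` membership of the parameter bricks -/

/-- `JU_mem_FP`. [folklore] -/
theorem JU_mem_FP : S.JU ∈ FP := comp_mem_FP (polyFn_mem_FP _) (polyFn_mem_FP _)
/-- `L0U_mem_FP`. [folklore] -/
theorem L0U_mem_FP : S.L0U ∈ FP := comp_mem_FP (cons_mem_FP true) JU_mem_FP
/-- `QcU_mem_FP`. [folklore] -/
theorem QcU_mem_FP : S.QcU ∈ FP :=
  (comp_mem_FP (polyFn_mem_FP _) (append_mem_FP (polyFn_mem_FP _) JU_mem_FP) :)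
/-- `cstU_mem_FP`. [folklore] -/
theorem cstU_mem_FP : S.cstU ∈ FP := (append_mem_FP L0U_mem_FP (append_mem_FP L0U_mem_FP (const_mem_FP _)) :)
/-- `lvl1U_mem_FP`. [folklore] -/
theorem lvl1U_mem_FP : lvl1U ∈ FP := comp_mem_FP (cons_mem_FP true) onesFn_mem_FP
/-- `t4U_mem_FP`. [folklore] -/
theorem t4U_mem_FP : S.t4U ∈ FP :=
  comp_mem_FP HashBricks.umulFn_mem_FP (fanoutFn_mem_FP (comp_mem_FP HashBricks.umulFn_mem_FP
    (fanoutFn_mem_FP cstU_mem_FP cstU_mem_FP)) lvl1U_mem_FP)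
/-- `tU_mem_FP`. [folklore] -/
theorem tU_mem_FP : S.tU ∈ FP := (append_mem_FP t4U_mem_FP (append_mem_FP t4U_mem_FP (append_mem_FP t4U_mem_FP t4U_mem_FP)) :)
/-- `ΔU_mem_FP`. [folklore] -/
theorem ΔU_mem_FP : S.ΔU ∈ FP :=
  (comp_mem_FP HashBricks.umulFn_mem_FP (fanoutFn_mem_FP L0U_mem_FP (comp_mem_FP HashBricks.umulFn_mem_FP
    (fanoutFn_mem_FP (append_mem_FP cstU_mem_FP cstU_mem_FP) lvl1U_mem_FP))) :)
/-- `xLenU_mem_FP`. [folklore] -/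
theorem xLenU_mem_FP : S.xLenU ∈ FP := comp_mem_FP HashBricks.umulFn_mem_FP (fanoutFn_mem_FP tU_mem_FP L0U_mem_FP)
/-- `M1U_mem_FP`. [folklore] -/
theorem M1U_mem_FP : S.M1U ∈ FP := (append_mem_FP xLenU_mem_FP tU_mem_FP :)
/-- `LzU_mem_FP`. [folklore] -/
theorem LzU_mem_FP : S.LzU ∈ FP := (append_mem_FP QcU_mem_FP (append_mem_FP QcU_mem_FP (const_mem_FP _)) :)
/-- `tLzU_mem_FP`. [folklore] -/
theorem tLzU_mem_FP : S.tLzU ∈ FP := comp_mem_FP HashBricks.umulFn_mem_FP (fanoutFn_mem_FP tU_mem_FP LzU_mem_FP)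
/-- `K1U_mem_FP`. [folklore] -/
theorem K1U_mem_FP : S.K1U ∈ FP :=
  comp_mem_FP HashBricks.umulFn_mem_FP (fanoutFn_mem_FP M1U_mem_FP (comp_mem_FP (cons_mem_FP true) tLzU_mem_FP))
/-- `K2U_mem_FP`. [folklore] -/
theorem K2U_mem_FP : S.K2U ∈ FP :=
  comp_mem_FP HashBricks.umulFn_mem_FP (fanoutFn_mem_FP xLenU_mem_FP (comp_mem_FP (cons_mem_FP true) xLenU_mem_FP))
/-- `subU_mem_FP`. [folklore] -/
theorem subU_mem_FP : S.subU ∈ FP :=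
  (append_mem_FP ΔU_mem_FP (append_mem_FP lvl1U_mem_FP (append_mem_FP lvl1U_mem_FP (const_mem_FP _))) :)
/-- `dmU_mem_FP`. [folklore] -/
theorem dmU_mem_FP : S.dmU ∈ FP :=
  comp_mem_FP divModFn_mem_FP (fanoutFn_mem_FP (comp_mem_FP L0U_mem_FP fstF_mem_FP)
    (comp_mem_FP onesFn_mem_FP (comp_mem_FP fstF_mem_FP sndF_mem_FP)))
/-- `jU_mem_FP`. [folklore] -/
theorem jU_mem_FP : S.jU ∈ FP := comp_mem_FP fstF_mem_FP dmU_mem_FP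
/-- `rhoU_mem_FP`. [folklore] -/
theorem rhoU_mem_FP : S.rhoU ∈ FP := comp_mem_FP sndF_mem_FP dmU_mem_FP
/-- `m1U_mem_FP`. [folklore] -/
theorem m1U_mem_FP : S.m1U ∈ FP :=
  (comp_mem_FP dropFn_mem_FP (fanoutFn_mem_FP (comp_mem_FP subU_mem_FP fstF_mem_FP) (append_mem_FP
    (comp_mem_FP HashBricks.umulFn_mem_FP (fanoutFn_mem_FP (comp_mem_FP t4U_mem_FP fstF_mem_FP) jU_mem_FP))
    (comp_mem_FP tU_mem_FP fstF_mem_FP))) :)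
/-- `m2U_mem_FP`. [folklore] -/
theorem m2U_mem_FP : S.m2U ∈ FP :=
  (comp_mem_FP dropFn_mem_FP (fanoutFn_mem_FP (append_mem_FP (comp_mem_FP HashBricks.umulFn_mem_FP
    (fanoutFn_mem_FP (comp_mem_FP t4U_mem_FP fstF_mem_FP) (comp_mem_FP (cons_mem_FP true) jU_mem_FP)))
    (comp_mem_FP subU_mem_FP fstF_mem_FP)) (comp_mem_FP xLenU_mem_FP fstF_mem_FP)) :)

end Params

/-! ### The seed split -/

section Seed

/-- The seed `s = sndF (sndF w)`. [folklore] -/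
noncomputable def seedF : List Bool → List Bool := sndF ∘ sndF
/-- `κ₁ = s ↾ K1`. [folklore] -/
noncomputable def k1F : List Bool → List Bool := takeFn ∘ fanoutFn (S.K1U ∘ fstF) seedF
/-- `s ⇂ K1`. [folklore] -/
noncomputable def r1F : List Bool → List Bool := dropFn ∘ fanoutFn (S.K1U ∘ fstF) seedF
/-- `κ₂ = (s ⇂ K1) ↾ K2`. [folklore] -/
noncomputable def k2F : List Bool → List Bool := takeFn ∘ fanoutFn (S.K2U ∘ fstF) S.r1F
/-- `x = s ⇂ (K1 + K2)`. [folklore] -/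
noncomputable def xF : List Bool → List Bool := dropFn ∘ fanoutFn (S.K2U ∘ fstF) S.r1F

variable {S}

/-- `length_ones''`. [folklore] -/
private theorem length_ones'' (a : ℕ) : (ones a).length = a := List.length_replicate ..

/-- `k1F_apply`. [folklore] -/
theorem k1F_apply (w : List Bool) : S.k1F w = (sndF (sndF w)).take (S.K1 (fstF w).length) := by
  rw [k1F, Function.comp_apply, fanoutFn_apply, Function.comp_apply, K1U_apply, seedF, Function.comp_apply,
    takeFn_boolPair, length_ones'']

/-- `r1F_apply`. [folklore] -/
theorem r1F_apply (w : List Bool) : S.r1F w = (sndF (sndF w)).drop (S.K1 (fstF w).length) := by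
  rw [r1F, Function.comp_apply, fanoutFn_apply, Function.comp_apply, K1U_apply, seedF, Function.comp_apply,
    dropFn_boolPair, length_ones'']

/-- `k2F_apply`. [folklore] -/
theorem k2F_apply (w : List Bool) : S.k2F w = ((sndF (sndF w)).drop (S.K1 (fstF w).length)).take (S.K2 (fstF w).length) := by
  rw [k2F, Function.comp_apply, fanoutFn_apply, Function.comp_apply, K2U_apply, r1F_apply, takeFn_boolPair, length_ones'']

/-- `xF_apply`. [folklore] -/
theorem xF_apply (w : List Bool) : S.xF w = (sndF (sndF w)).drop (S.K1 (fstF w).length + S.K2 (fstF w).length) := by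
  rw [xF, Function.comp_apply, fanoutFn_apply, Function.comp_apply, K2U_apply, r1F_apply, dropFn_boolPair, length_ones'',
    List.drop_drop]

/-- `seedF_mem_FP`. [folklore] -/
theorem seedF_mem_FP : seedF ∈ FP := comp_mem_FP sndF_mem_FP sndF_mem_FP
/-- `k1F_mem_FP`. [folklore] -/
theorem k1F_mem_FP : S.k1F ∈ FP := comp_mem_FP takeFn_mem_FP (fanoutFn_mem_FP (comp_mem_FP K1U_mem_FP fstF_mem_FP) seedF_mem_FP)
/-- `r1F_mem_FP`. [folklore] -/
theorem r1F_mem_FP : S.r1F ∈ FP := comp_mem_FP dropFn_mem_FP (fanoutFn_mem_FP (comp_mem_FP K1U_mem_FP fstF_mem_FP) seedF_mem_FP)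
/-- `k2F_mem_FP`. [folklore] -/
theorem k2F_mem_FP : S.k2F ∈ FP := comp_mem_FP takeFn_mem_FP (fanoutFn_mem_FP (comp_mem_FP K2U_mem_FP fstF_mem_FP) r1F_mem_FP)
/-- `xF_mem_FP`. [folklore] -/
theorem xF_mem_FP : S.xF ∈ FP := comp_mem_FP dropFn_mem_FP (fanoutFn_mem_FP (comp_mem_FP K2U_mem_FP fstF_mem_FP) r1F_mem_FP)

end Seed

/-! ### The coded tuple: a `foldCat` over the blocks -/

section Tuple

/-- The context handed to the fold: `⟨⟨1ⁿ, 1^{ρ̃}⟩, x⟩`. [folklore] -/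
noncomputable def ctxF : List Bool → List Bool := fanoutFn (fanoutFn (onesFn ∘ fstF) S.rhoU) S.xF

/-- Inside the body (`z' = ⟨ctx, 1^ℓ⟩`): the level `1ⁿ`. [folklore] -/
noncomputable def bnF : List Bool → List Bool := fstF ∘ fstF ∘ fstF
/-- `1^{ρ̃}`. [folklore] -/
noncomputable def brF : List Bool → List Bool := sndF ∘ fstF ∘ fstF
/-- `x`. [folklore] -/
noncomputable def bxF : List Bool → List Bool := sndF ∘ fstF
/-- `1^{L0 n}` recomputed from the level. [folklore] -/
noncomputable def bL0F : List Bool → List Bool := S.L0U ∘ bnF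
/-- `1^{Qc n}` recomputed from the level. [folklore] -/
noncomputable def bQcF : List Bool → List Bool := S.QcU ∘ bnF
/-- The block `x_ℓ = (x ⇂ ℓ·L0) ↾ L0`. [folklore] -/
noncomputable def blkF : List Bool → List Bool :=
  takeFn ∘ fanoutFn S.bL0F (dropFn ∘ fanoutFn (HashBricks.umulFn ∘ fanoutFn sndF S.bL0F) bxF)
/-- The bit `[b_ℓ]`. [folklore] -/
noncomputable def bitF : List Bool → List Bool := HashBricks.headBitFn ∘ S.blkF
/-- The coins `r_ℓ ↾ ρ̃`. [folklore] -/
noncomputable def coinF : List Bool → List Bool :=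
  takeFn ∘ fanoutFn brF (dropFn ∘ fanoutFn (fun _ => [true]) S.blkF)
/-- The commitment `commit(1ⁿ, b_ℓ; r_ℓ ↾ ρ̃)` (the sender's machine). [cite: Goldreich2001, Def. 4.4.1] -/
noncomputable def comF : List Bool → List Bool := comB S.C ∘ fanoutFn bnF (fanoutFn S.bitF S.coinF)
/-- The header `(1^{|c|} 0^{Qc}) ↾ Qc`. [folklore] -/
noncomputable def hdrF : List Bool → List Bool :=
  takeFn ∘ fanoutFn S.bQcF (fun z => onesFn (S.comF z) ++ Kannan.zerosFn (S.bQcF z))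
/-- The body `(c 0^{Qc}) ↾ Qc`. [folklore] -/
noncomputable def bdyF : List Bool → List Bool :=
  takeFn ∘ fanoutFn S.bQcF (fun z => S.comF z ++ Kannan.zerosFn (S.bQcF z))
/-- **The fold body**: the coded pair of block `ℓ`. [cite: Luby1996, Lecture 10, Theorem 10.3 (`f(y_i)`)] -/
noncomputable def pieceF : List Bool → List Bool := fun z => S.hdrF z ++ (S.bdyF z ++ S.bitF z)

/-- A clip bound on the pieces: `Lz n ≤ LzP(m)` for `m ≥ n`. [folklore] -/
noncomputable def LzP : Polynomial ℕ := 2 * S.Qp.comp (2 * X + 6 + S.Jp.comp (2 * X + 3)) + 1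

/-- A round bound: `t n ≤ tP(m)` for `m ≥ n`. [folklore] -/
noncomputable def tP : Polynomial ℕ := 4 * ((2 * (S.Jp.comp (2 * X + 3) + 1) + 2) ^ 2 * (X + 1))

/-- **The coded tuple** `zStr` as a fold. [cite: Luby1996, Lecture 10, Theorem 10.3 (`f'(y)`)] -/
noncomputable def zF : List Bool → List Bool := foldCat S.LzP S.tP S.pieceF ∘ fanoutFn S.ctxF (S.tU ∘ fstF)

variable {S}

/-- `LzP_eval`. [folklore] -/
theorem LzP_eval (m : ℕ) : S.LzP.eval m = S.Lz m := by
  simp only [LzP, eval_add, eval_mul, eval_comp, eval_ofNat, eval_X, eval_one, Lz, Qc, J]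

/-- `tP_eval`. [folklore] -/
theorem tP_eval (m : ℕ) : S.tP.eval m = S.t m := by
  simp only [tP, eval_add, eval_mul, eval_pow, eval_comp, eval_ofNat, eval_X, eval_one, t, t4, cst, L0, J]

/-- `Lz_mono`. [folklore] -/
theorem Lz_mono {n m : ℕ} (h : n ≤ m) : S.Lz n ≤ S.Lz m := by
  rw [← LzP_eval, ← LzP_eval]; exact TM2Iter.eval_mono _ h

/-- `t_mono`. [folklore] -/
theorem t_mono {n m : ℕ} (h : n ≤ m) : S.t n ≤ S.t m := by
  rw [← tP_eval, ← tP_eval]; exact TM2Iter.eval_mono _ h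

/-- The context on input `w`. [folklore] -/
theorem ctxF_apply (w : List Bool) :
    S.ctxF w = boolPair (boolPair (ones (fstF w).length) (ones (S.rhoOf (fstF w).length (fstF (sndF w)).length)))
      ((sndF (sndF w)).drop (S.K1 (fstF w).length + S.K2 (fstF w).length)) := by
  rw [ctxF, fanoutFn_apply, fanoutFn_apply, Function.comp_apply, rhoU_apply, xF_apply, onesFn, unaryEncodeNat_eq_replicate, ones]

section Body

variable (n ρ ℓ : ℕ) (xs : List Bool)

omit S in
/-- `bnF_Z`. [folklore] -/
private theorem bnF_Z : bnF (boolPair (boolPair (boolPair (ones n) (ones ρ)) xs) (ones ℓ)) = ones n := by simp [bnF]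
omit S in
/-- `brF_Z`. [folklore] -/
private theorem brF_Z : brF (boolPair (boolPair (boolPair (ones n) (ones ρ)) xs) (ones ℓ)) = ones ρ := by simp [brF]
omit S in
/-- `bxF_Z`. [folklore] -/
private theorem bxF_Z : bxF (boolPair (boolPair (boolPair (ones n) (ones ρ)) xs) (ones ℓ)) = xs := by simp [bxF]

/-- `bL0F_Z`. [folklore] -/
private theorem bL0F_Z : S.bL0F (boolPair (boolPair (boolPair (ones n) (ones ρ)) xs) (ones ℓ)) = ones (S.L0 n) := by
  rw [bL0F, Function.comp_apply, bnF_Z, L0U_apply, ones, List.length_replicate]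

/-- `bQcF_Z`. [folklore] -/
private theorem bQcF_Z : S.bQcF (boolPair (boolPair (boolPair (ones n) (ones ρ)) xs) (ones ℓ)) = ones (S.Qc n) := by
  rw [bQcF, Function.comp_apply, bnF_Z, QcU_apply, ones, List.length_replicate]

/-- `blkF_Z`. [folklore] -/
private theorem blkF_Z : S.blkF (boolPair (boolPair (boolPair (ones n) (ones ρ)) xs) (ones ℓ)) = blk (S.L0 n) ℓ xs := by
  simp only [blkF, Function.comp_apply, fanoutFn_apply, bL0F_Z, bxF_Z, sndF_boolPair, HashBricks.umulFn_boolPair,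
    dropFn_boolPair, takeFn_boolPair, ones, List.length_replicate, blk]

/-- `bitF_Z`. [folklore] -/
private theorem bitF_Z : S.bitF (boolPair (boolPair (boolPair (ones n) (ones ρ)) xs) (ones ℓ)) = [(blk (S.L0 n) ℓ xs).headD false] := by
  rw [bitF, Function.comp_apply, blkF_Z, HashBricks.headBitFn_apply]

/-- `coinF_Z`. [folklore] -/
private theorem coinF_Z : S.coinF (boolPair (boolPair (boolPair (ones n) (ones ρ)) xs) (ones ℓ)) = ((blk (S.L0 n) ℓ xs).drop 1).take ρ := by
  simp only [coinF, Function.comp_apply, fanoutFn_apply, brF_Z, blkF_Z, dropFn_boolPair, takeFn_boolPair, ones,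
    List.length_replicate, List.length_singleton]

/-- `comF_Z`. [folklore] -/
private theorem comF_Z : S.comF (boolPair (boolPair (boolPair (ones n) (ones ρ)) xs) (ones ℓ)) = S.comRun n ((blk (S.L0 n) ℓ xs).headD false) (((blk (S.L0 n) ℓ xs).drop 1).take ρ) := by
  simp only [comF, Function.comp_apply, fanoutFn_apply, bnF_Z, bitF_Z, coinF_Z, comB, fstF_boolPair, sndF_boolPair,
    ones, List.length_replicate, List.headD_cons, comRun]

/-- **The body computes the coded pair of block `ℓ`.** [cite: Luby1996, Lecture 10, Theorem 10.3 (`f(y_i)`)] -/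
theorem pieceF_apply : S.pieceF (boolPair (boolPair (boolPair (ones n) (ones ρ)) xs) (ones ℓ)) = S.blockZ n ρ (blk (S.L0 n) ℓ xs) := by
  simp only [pieceF, hdrF, bdyF, Function.comp_apply, fanoutFn_apply, bQcF_Z, comF_Z, bitF_Z, takeFn_boolPair,
    onesFn, unaryEncodeNat_eq_replicate, Kannan.zerosFn_apply, ones, List.length_replicate, blockZ, encP]

end Body

/-- **The fold computes the coded tuple.** [cite: Luby1996, Lecture 10, Theorem 10.3 (`f'(y)`)] -/
theorem zF_apply (w : List Bool) :
    S.zF w = S.zStr (fstF w).length (S.rhoOf (fstF w).length (fstF (sndF w)).length)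
      ((sndF (sndF w)).drop (S.K1 (fstF w).length + S.K2 (fstF w).length)) := by
  rw [zF, Function.comp_apply, fanoutFn_apply, ctxF_apply, Function.comp_apply, tU_apply]
  generalize (fstF w).length = n
  generalize (sndF (sndF w)).drop (S.K1 n + S.K2 n) = xs
  generalize S.rhoOf n (fstF (sndF w)).length = ρ
  have hlen : n ≤ (boolPair (boolPair (ones n) (ones ρ)) xs).length := by
    simp only [length_boolPair, ones, List.length_replicate]; omega
  have hl : (ones (S.t n)).length = S.t n := List.length_replicate ..
  rw [foldCat_apply, zStr, hl]
  · simp only [pieceF_apply]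
  · rw [hl, tP_eval]; exact t_mono hlen
  · intro ℓ _
    rw [pieceF_apply, blockZ, length_encP, LzP_eval]
    exact Lz_mono hlen

/-- `ctxF_mem_FP`. [folklore] -/
theorem ctxF_mem_FP : S.ctxF ∈ FP :=
  fanoutFn_mem_FP (fanoutFn_mem_FP (comp_mem_FP onesFn_mem_FP fstF_mem_FP) rhoU_mem_FP) xF_mem_FP
/-- `bnF_mem_FP`. [folklore] -/
theorem bnF_mem_FP : bnF ∈ FP := comp_mem_FP fstF_mem_FP (comp_mem_FP fstF_mem_FP fstF_mem_FP)
/-- `brF_mem_FP`. [folklore] -/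
theorem brF_mem_FP : brF ∈ FP := comp_mem_FP sndF_mem_FP (comp_mem_FP fstF_mem_FP fstF_mem_FP)
/-- `bxF_mem_FP`. [folklore] -/
theorem bxF_mem_FP : bxF ∈ FP := comp_mem_FP sndF_mem_FP fstF_mem_FP
/-- `bL0F_mem_FP`. [folklore] -/
theorem bL0F_mem_FP : S.bL0F ∈ FP := comp_mem_FP L0U_mem_FP bnF_mem_FP
/-- `bQcF_mem_FP`. [folklore] -/
theorem bQcF_mem_FP : S.bQcF ∈ FP := comp_mem_FP QcU_mem_FP bnF_mem_FP
/-- `blkF_mem_FP`. [folklore] -/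
theorem blkF_mem_FP : S.blkF ∈ FP :=
  comp_mem_FP takeFn_mem_FP (fanoutFn_mem_FP bL0F_mem_FP (comp_mem_FP dropFn_mem_FP (fanoutFn_mem_FP
    (comp_mem_FP HashBricks.umulFn_mem_FP (fanoutFn_mem_FP sndF_mem_FP bL0F_mem_FP)) bxF_mem_FP)))
/-- `bitF_mem_FP`. [folklore] -/
theorem bitF_mem_FP : S.bitF ∈ FP := comp_mem_FP HashBricks.headBitFn_mem_FP blkF_mem_FP
/-- `coinF_mem_FP`. [folklore] -/
theorem coinF_mem_FP : S.coinF ∈ FP :=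
  comp_mem_FP takeFn_mem_FP (fanoutFn_mem_FP brF_mem_FP (comp_mem_FP dropFn_mem_FP (fanoutFn_mem_FP (const_mem_FP _) blkF_mem_FP)))
/-- `comF_mem_FP`. [folklore] -/
theorem comF_mem_FP (hS : S.WF) : S.comF ∈ FP := comp_mem_FP hS.hcom (fanoutFn_mem_FP bnF_mem_FP (fanoutFn_mem_FP bitF_mem_FP coinF_mem_FP))
/-- `hdrF_mem_FP`. [folklore] -/
theorem hdrF_mem_FP (hS : S.WF) : S.hdrF ∈ FP :=
  (comp_mem_FP takeFn_mem_FP (fanoutFn_mem_FP bQcF_mem_FP (append_mem_FP (comp_mem_FP onesFn_mem_FP (comF_mem_FP hS))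
    (comp_mem_FP Kannan.zerosFn_mem_FP bQcF_mem_FP))) :)
/-- `bdyF_mem_FP`. [folklore] -/
theorem bdyF_mem_FP (hS : S.WF) : S.bdyF ∈ FP :=
  (comp_mem_FP takeFn_mem_FP (fanoutFn_mem_FP bQcF_mem_FP (append_mem_FP (comF_mem_FP hS)
    (comp_mem_FP Kannan.zerosFn_mem_FP bQcF_mem_FP))) :)
/-- `pieceF_mem_FP`. [folklore] -/
theorem pieceF_mem_FP (hS : S.WF) : S.pieceF ∈ FP :=
  (append_mem_FP (hdrF_mem_FP hS) (append_mem_FP (bdyF_mem_FP hS) bitF_mem_FP) :)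
/-- `zF_mem_FP`. [folklore] -/
theorem zF_mem_FP (hS : S.WF) : S.zF ∈ FP :=
  comp_mem_FP (foldCat_mem_FP _ _ (pieceF_mem_FP hS)) (fanoutFn_mem_FP ctxF_mem_FP (comp_mem_FP tU_mem_FP fstF_mem_FP))

end Tuple

/-! ### The hashes and the assembly -/

section Assembly

/-- `h¹_{κ₁}(z)` to `m1` bits. [cite: Luby1996, Lecture 10, Theorem 10.3 (`h_{y'}(f'(y))`)] -/
noncomputable def h1F : List Bool → List Bool :=
  AffineProg.hashFn ∘ fanoutFn (fanoutFn (S.tLzU ∘ fstF) S.m1U) (fanoutFn S.k1F S.zF)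
/-- `h²_{κ₂}(x)` to `m2` bits. [cite: Luby1996, Lecture 10, Theorem 10.3 (`h'_{y''}(y)`)] -/
noncomputable def h2F : List Bool → List Bool :=
  AffineProg.hashFn ∘ fanoutFn (fanoutFn (S.xLenU ∘ fstF) S.m2U) (fanoutFn S.k2F S.xF)
/-- The clamped payload `(h¹ ‖ h² ‖ 0^{xLen+1}) ↾ (xLen + 1)`. [folklore] -/
noncomputable def payF : List Bool → List Bool :=
  takeFn ∘ fanoutFn (List.cons true ∘ S.xLenU ∘ fstF) (fun w => S.h1F w ++ (S.h2F w ++ (Kannan.zerosFn ∘ List.cons true ∘ S.xLenU ∘ fstF) w))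
/-- **The program of the candidate generators.** [cite: Luby1996, Lecture 10, Theorem 10.3 (`g(y, y', y'')`)] -/
noncomputable def candFn : List Bool → List Bool := fun w => S.k1F w ++ (S.k2F w ++ S.payF w)

variable {S}

/-- `h1F_apply`. [folklore] -/
theorem h1F_apply (w : List Bool) :
    S.h1F w = hashStr (S.t (fstF w).length * S.Lz (fstF w).length) (S.m1 (fstF w).length (S.jOf (fstF w).length (fstF (sndF w)).length))
      ((sndF (sndF w)).take (S.K1 (fstF w).length))
      (S.zStr (fstF w).length (S.rhoOf (fstF w).length (fstF (sndF w)).length)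
        ((sndF (sndF w)).drop (S.K1 (fstF w).length + S.K2 (fstF w).length))) := by
  rw [h1F, Function.comp_apply, fanoutFn_apply, fanoutFn_apply, fanoutFn_apply, Function.comp_apply, tLzU_apply, m1U_apply,
    k1F_apply, zF_apply, AffineProg.hashFn_boolPair]

/-- `h2F_apply`. [folklore] -/
theorem h2F_apply (w : List Bool) :
    S.h2F w = hashStr (S.xLen (fstF w).length) (S.m2 (fstF w).length (S.jOf (fstF w).length (fstF (sndF w)).length))
      (((sndF (sndF w)).drop (S.K1 (fstF w).length)).take (S.K2 (fstF w).length))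
      ((sndF (sndF w)).drop (S.K1 (fstF w).length + S.K2 (fstF w).length)) := by
  rw [h2F, Function.comp_apply, fanoutFn_apply, fanoutFn_apply, fanoutFn_apply, Function.comp_apply, xLenU_apply, m2U_apply,
    k2F_apply, xF_apply, AffineProg.hashFn_boolPair]

/-- **The program computes the indexed sampler on every input.** [cite: Luby1996, Lecture 10, Theorem 10.3] -/
theorem candFn_apply (w : List Bool) : S.candFn w = S.candI w := by
  rw [candFn, payF, Function.comp_apply, fanoutFn_apply, takeFn_boolPair, k1F_apply, k2F_apply, h1F_apply, h2F_apply]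
  simp only [Function.comp_apply, xLenU_apply, Kannan.zerosFn_apply, List.length_cons, ones, List.length_replicate, candI, cand,
    List.append_assoc]

/-- `h1F_mem_FP`. [folklore] -/
theorem h1F_mem_FP (hS : S.WF) : S.h1F ∈ FP :=
  comp_mem_FP AffineProg.hashFn_mem_FP (fanoutFn_mem_FP (fanoutFn_mem_FP (comp_mem_FP tLzU_mem_FP fstF_mem_FP) m1U_mem_FP)
    (fanoutFn_mem_FP k1F_mem_FP (zF_mem_FP hS)))
/-- `h2F_mem_FP`. [folklore] -/
theorem h2F_mem_FP : S.h2F ∈ FP :=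
  comp_mem_FP AffineProg.hashFn_mem_FP (fanoutFn_mem_FP (fanoutFn_mem_FP (comp_mem_FP xLenU_mem_FP fstF_mem_FP) m2U_mem_FP)
    (fanoutFn_mem_FP k2F_mem_FP xF_mem_FP))
/-- `payF_mem_FP`. [folklore] -/
theorem payF_mem_FP (hS : S.WF) : S.payF ∈ FP :=
  (comp_mem_FP takeFn_mem_FP (fanoutFn_mem_FP (comp_mem_FP (cons_mem_FP true) (comp_mem_FP xLenU_mem_FP fstF_mem_FP))
    (append_mem_FP (h1F_mem_FP hS) (append_mem_FP h2F_mem_FP (comp_mem_FP Kannan.zerosFn_mem_FP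
      (comp_mem_FP (cons_mem_FP true) (comp_mem_FP xLenU_mem_FP fstF_mem_FP)))))) :)
/-- `candFn_mem_FP`. [folklore] -/
theorem candFn_mem_FP (hS : S.WF) : S.candFn ∈ FP :=
  (append_mem_FP k1F_mem_FP (append_mem_FP k2F_mem_FP (payF_mem_FP hS)) :)

/-- **The family of candidate generators is polynomial-time** (one `FP` function of level, index and seed).
[cite: Luby1996, Lecture 10, Theorem 10.3 ("`g` … is a **P**-time function ensemble")] -/
theorem candI_mem_FP (hS : S.WF) : S.candI ∈ FP := by
  have h : S.candI = S.candFn := funext fun w => (candFn_apply w).symm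
  rw [h]
  exact candFn_mem_FP hS

end Assembly

end Setup

end ComPRG

end Literature.Computability.Cryptography
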